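import Literature.NumberTheory.Automorphic.ReductionTheoryGLnSiegelPropertyProofs
import Literature.NumberTheory.Automorphic.SiegelSetAbsorption
import Literature.NumberTheory.Automorphic.BianchiSiegelFiniteness
import Literature.NumberTheory.Automorphic.AutomorphicRepsGLCuspFormsRapidDecay
import Literature.NumberTheory.Automorphic.QuaternionAlgebraAdelicProofs
import Summits.Langlands.Langlands.Theorems.IrreducibilityBySelfDualityHeckeEigenvalueFieldStubArchFundamentalSet
import HarnessLib

/-!
# The Siegel property in `GL_n(K ⊗ ℝ)` with bounded finite part, all `n`, all number fields `K`

Crux `HeckeEigenvalueField` (stmt-Langlands-13632), line `Sketch`, stub `stub_archSiegelProperty`.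

For the archimedean group `H = GL_n(K ⊗_ℚ ℝ) = GL (Fin n) (mixedSpace K)`, a relatively compact
piece `Ω` of the Borel subgroup `B(𝔸_K)` with trivial finite part (`Ω ⊆ range GLn.ofInfinite`),
`t > 0` and a compact `Q ⊆ GL_n(𝔸_K^∞)`, only finitely many `γ ∈ GL_n(K)` with finite part
`γ_f ∈ Q` satisfy `θ(γ) · b = b' · k` with `b, b'` archimedean components of elements of
`A_G · Ω · A_{T₀}(t)` and `k ∈ K_∞ = Kinf n K` (`θ = GL_n(mixedEmbedding K)`).  This is the
all-`(n, K)` generalisation of the landed `finite_siegelProperty_bianchi` (`GL₂`, `K` imaginary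
quadratic), and the proof transposes that one: it is DERIVED from the PROVED adelic Siegel property
`siegelFiniteness_gl_holds` (Borel; Godement, Sém. Bourbaki 257 §10 Thm. 9:
`{γ ∈ GL_n(K) : γ A_G S ∩ A_G S' ≠ ∅}` is finite for Siegel sets `S, S'`) and the absorption lemma
`exists_isSiegelSetGL_mul_siegelCone_mul_subset` (`C · A_{T₀}(t) · K ⊆ A_G · S` for compact
`C ⊆ B(𝔸_K)`).

Proof.  `γ ↦ γ̂ = (γ, γ) ∈ GL_n(𝔸_K)` is injective, and for `θ(γ) b = b' k` with `b = x_∞`,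
`x = z ω a`, `b' = x'_∞`, `x' = z' ω' a'` one has `γ̂ · (x · (1, γ_f⁻¹)) = x' · (k, 1)` in
`GL_n(𝔸_K) = GL_n(K_∞) × GL_n(𝔸_K^∞)` (compare archimedean and finite parts; `z, ω, a` have trivial
finite part).  Both sides lie in `A_G · S` for the Siegel set `S` absorbing
`C = closure Ω · (1, T)`, where `T ∋ 1` is a finite set of upper triangular `β ∈ GL_n(𝔸_K^∞)` with
`Q⁻¹ ⊆ ⋃_β β · GL_n(𝒪̂_K)` (finite Iwasawa decomposition and compactness of `Q⁻¹`): writing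
`γ_f⁻¹ = β w`, `x (1, γ_f⁻¹) = z · (ω (1, β)) · a · (1, w)` since `(1, β)` commutes with the
archimedean torus element `a`, and `(1, w), (k, 1) ∈ K`.  So `γ ↦ γ̂` maps our set injectively into
the finite set of `siegelFiniteness_gl.finite_of_center_mul`.

## References

* A. Borel, *Introduction aux groupes arithmétiques*, Hermann (1969), §15 [Borel1969].
* R. Godement, *Domaines fondamentaux des groupes arithmétiques*, Sém. Bourbaki 257 (1962/63),
  §10, Théorème 9 (Borel); English translation in A. Borel, R. Godement, C. L. Siegel, A. Weil,
  *Arithmetic groups and reduction theory* (2020), PDF p. 170 [BorelEtAl2020].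
-/

noncomputable section

set_option linter.dupNamespace false

open scoped Pointwise NNReal MatrixGroups
open NumberField NumberField.mixedEmbedding IsDedekindDomain Literature.NumberTheory.Automorphic

namespace Summit.Langlands.Langlands.Theorems.HeckeEigenvalueField.Res

variable {n : ℕ} {K : Type} [Field K] [NumberField K]

/-- An element of `GL_n(𝔸_K) = GL_n(K_∞) × GL_n(𝔸_K^∞)` is determined by its archimedean
component in `GL_n(mixedSpace K)` (`GLn.toMixed`) and its finite part (`GLn.sndHom`). [folklore] -/
theorem archSP_ext_of_toMixed_of_sndHom {x y : GL (Fin n) (AdeleRing (𝓞 K) K)}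
    (h₁ : GLn.toMixed n K x = GLn.toMixed n K y) (h₂ : GLn.sndHom n K x = GLn.sndHom n K y) :
    x = y := by
  rw [GLn.toMixed_apply, GLn.toMixed_apply] at h₁
  exact GLn.ext_of_fstHom_of_sndHom ((GLn.infiniteEquivMixed n K).injective h₁) h₂

/-- Positive real scalars `z ∈ A_G` have trivial finite part. [folklore] -/
theorem archSP_sndHom_eq_one_of_mem_range_posRealScalar {z : GL (Fin n) (AdeleRing (𝓞 K) K)}
    (hz : z ∈ (posRealScalar n K).range) : GLn.sndHom n K z = 1 := by
  obtain ⟨ρ, rfl⟩ := MonoidHom.mem_range.1 hz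
  exact GLn.sndHom_posRealScalar ρ

/-- Elements of the cone `A_{T₀}(t)` have trivial finite part. [folklore] -/
theorem archSP_sndHom_eq_one_of_mem_siegelCone {t : ℝ} {a : GL (Fin n) (AdeleRing (𝓞 K) K)}
    (ha : a ∈ siegelCone n K t) : GLn.sndHom n K a = 1 := by
  obtain ⟨α, -, -, rfl⟩ := mem_siegelCone_iff.1 ha
  exact GLn.sndHom_posRealDiagonal α

/-- Elements of `range GLn.ofInfinite` have trivial finite part. [folklore] -/
theorem archSP_sndHom_eq_one_of_mem_range_ofInfinite {ω : GL (Fin n) (AdeleRing (𝓞 K) K)}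
    (hω : ω ∈ Set.range (GLn.ofInfinite n K)) : GLn.sndHom n K ω = 1 := by
  obtain ⟨g, rfl⟩ := hω
  exact GLn.sndHom_ofInfinite g

/-- **Rational points: `γ ↦ (γ, γ) ∈ GL_n(𝔸_K)` is injective** (read the archimedean component,
`archFS_toMixed_map_algebraMap`, and use injectivity of the mixed embedding). [folklore] -/
theorem archSP_map_algebraMap_injective :
    Function.Injective
      (Matrix.GeneralLinearGroup.map (n := Fin n) (algebraMap K (AdeleRing (𝓞 K) K))) := by
  intro γ γ' h
  have h' := congrArg (GLn.toMixed n K) h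
  rw [archFS_toMixed_map_algebraMap, archFS_toMixed_map_algebraMap] at h'
  refine Matrix.GeneralLinearGroup.ext fun i j => mixedEmbedding_injective K ?_
  exact (Matrix.GeneralLinearGroup.ext_iff _ _).mp h' i j

/-- **Stub SP — the Siegel property in `GL_n(K ⊗ ℝ)` with bounded finite part, all `n`, all `K`**
(archimedean form of the PROVED adelic Siegel property `siegelFiniteness_gl_holds` through the
absorption lemma `exists_isSiegelSetGL_mul_siegelCone_mul_subset`): for a relatively compact
archimedean piece `Ω` of the Borel subgroup, `t > 0` and a compact `Q ⊆ GL_n(𝔸_K^∞)`, only finitely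
many `γ ∈ GL_n(K)` with `γ_f ∈ Q` have `θ(γ) b = b' k` with `b, b'` archimedean components of
`A_G · Ω · A_{T₀}(t)` and `k ∈ K_∞` (module docstring for the proof; `Ω ⊆ range GLn.ofInfinite` is
used only through "trivial finite part"). [cite: Borel1969, §15]
[cite: BorelEtAl2020, Godement Sém. Bourbaki 257 §10 Thm. 9] -/
theorem stub_archSiegelProperty (n : ℕ) (K : Type) [Field K] [NumberField K]
    (Ω : Set (GL (Fin n) (AdeleRing (𝓞 K) K)))
    (hΩB : Ω ⊆ (standardParabolicGL (AdeleRing (𝓞 K) K) (id : Fin n → Fin n) :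
      Set (GL (Fin n) (AdeleRing (𝓞 K) K))))
    (hΩinf : Ω ⊆ Set.range (GLn.ofInfinite n K)) (hΩc : IsCompact (closure Ω))
    (t : ℝ) (ht : 0 < t) (Q : Set (GL (Fin n) (FiniteAdeleRing (𝓞 K) K))) (hQ : IsCompact Q) :
    {γ : GL (Fin n) K |
      Matrix.GeneralLinearGroup.map (algebraMap K (FiniteAdeleRing (𝓞 K) K)) γ ∈ Q ∧
      ∃ b ∈ GLn.toMixed n K ''
          (((posRealScalar n K).range : Set (GL (Fin n) (AdeleRing (𝓞 K) K))) * Ω * siegelCone n K t),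
      ∃ b' ∈ GLn.toMixed n K ''
          (((posRealScalar n K).range : Set (GL (Fin n) (AdeleRing (𝓞 K) K))) * Ω * siegelCone n K t),
      ∃ k ∈ Kinf n K, Matrix.GeneralLinearGroup.map (mixedEmbedding K) γ * b = b' * k}.Finite := by
  haveI : T2Space (AdeleRing (𝓞 K) K) := t2Space_adeleRing K
  -- (1) the finite part: `Q⁻¹ ⊆ ⋃_{β ∈ T} β · GL_n(𝒪̂_K)`, `T ⊆ B(𝔸_K^∞)` finite, `1 ∈ T`
  obtain ⟨T, hTf, hT1, hTB, hT⟩ :=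
    BianchiSiegelFiniteness.exists_finite_borel_cover Q⁻¹ hQ.inv
  -- (2) the compact piece `C = closure Ω · (1, T) ⊆ B(𝔸_K)` and its absorbing Siegel set `S`
  have hC : IsCompact (closure Ω * (GLn.ofFinite n K '' T)) := hΩc.mul (hTf.image _).isCompact
  have hclB : closure Ω ⊆ (standardParabolicGL (AdeleRing (𝓞 K) K) (id : Fin n → Fin n) :
      Set (GL (Fin n) (AdeleRing (𝓞 K) K))) :=
    closure_minimal hΩB isClosed_standardParabolicGL_id
  have hCB : closure Ω * (GLn.ofFinite n K '' T) ⊆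
      (standardParabolicGL (AdeleRing (𝓞 K) K) (id : Fin n → Fin n) :
        Set (GL (Fin n) (AdeleRing (𝓞 K) K))) := by
    rintro _ ⟨u, hu, _, ⟨β, hβ, rfl⟩, rfl⟩
    exact Subgroup.mul_mem _ (hclB hu) (ofFinite_mem_standardParabolicGL n K (hTB β hβ))
  obtain ⟨S, hS, hsub⟩ := exists_isSiegelSetGL_mul_siegelCone_mul_subset n K _ hC hCB t ht
  -- (3) the adelic Siegel property, symmetric form
  have hfin := siegelFiniteness_gl.finite_of_center_mul
    (siegelFiniteness_gl_holds (n := n) (K := K)) hS hS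
  -- (4) `γ ↦ (γ, γ)` maps our set injectively into that finite set
  refine (hfin.preimage archSP_map_algebraMap_injective.injOn).subset ?_
  rintro γ ⟨hγQ, b, hb, b', hb', k, hk, hrel⟩
  obtain ⟨x, hx, rfl⟩ := hb
  obtain ⟨x', hx', rfl⟩ := hb'
  obtain ⟨_, ⟨z, hz, ω, hω, rfl⟩, a, ha, rfl⟩ := hx
  obtain ⟨_, ⟨z', hz', ω', hω', rfl⟩, a', ha', rfl⟩ := hx'
  beta_reduce at hrel
  -- trivial finite parts
  have hz1 := archSP_sndHom_eq_one_of_mem_range_posRealScalar hz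
  have hz1' := archSP_sndHom_eq_one_of_mem_range_posRealScalar hz'
  have hω1 := archSP_sndHom_eq_one_of_mem_range_ofInfinite (hΩinf hω)
  have hω1' := archSP_sndHom_eq_one_of_mem_range_ofInfinite (hΩinf hω')
  have ha1 := archSP_sndHom_eq_one_of_mem_siegelCone ha
  have ha1' := archSP_sndHom_eq_one_of_mem_siegelCone ha'
  -- the pieces: `γ_f⁻¹ = β w`
  obtain ⟨βf, hβf, w, hw, hβw⟩ := hT _ (Set.inv_mem_inv.2 hγQ)
  have hm : ω * GLn.ofFinite n K βf * a * GLn.ofFinite n K w ∈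
      ((posRealScalar n K).range : Set (GL (Fin n) (AdeleRing (𝓞 K) K))) * S :=
    hsub (Set.mul_mem_mul (Set.mul_mem_mul
      (Set.mul_mem_mul (subset_closure hω) (Set.mem_image_of_mem _ hβf)) ha)
      (glIntegralLevel_le_standardMaximalCompactGL (GLn.ofFinite_mem_glIntegralLevel hw)))
  have hm' : ω' * GLn.ofFinite n K 1 * a' * GLn.ofInfinite n K k ∈
      ((posRealScalar n K).range : Set (GL (Fin n) (AdeleRing (𝓞 K) K))) * S :=
    hsub (Set.mul_mem_mul (Set.mul_mem_mul
      (Set.mul_mem_mul (subset_closure hω') (Set.mem_image_of_mem _ hT1)) ha')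
      (map_Kinf_le_standardMaximalCompactGL (Subgroup.mem_map_of_mem _ hk)))
  obtain ⟨z₂, hz₂, s, hs, hzs⟩ := hm
  obtain ⟨z₂', hz₂', s', hs', hzs'⟩ := hm'
  beta_reduce at hzs hzs'
  refine ⟨⟨γ, rfl⟩, z * z₂, mul_mem hz hz₂, s, hs, z' * z₂', mul_mem hz' hz₂', s', hs', ?_⟩
  -- the finite factor `(1, β)` commutes with the archimedean torus element `a`
  have hcomm : a * GLn.ofFinite n K βf = GLn.ofFinite n K βf * a :=
    (BianchiSiegelFiniteness.commute_of_sndHom_eq_one_of_fstHom_eq_one ha1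
      (GLn.fstHom_ofFinite βf)).eq
  -- `γ̂ · (x (1, γ_f⁻¹)) = x' (k, 1)`: compare archimedean and finite parts
  have hkey : Matrix.GeneralLinearGroup.map (algebraMap K (AdeleRing (𝓞 K) K)) γ *
      (z * ω * a * GLn.ofFinite n K
        (Matrix.GeneralLinearGroup.map (algebraMap K (FiniteAdeleRing (𝓞 K) K)) γ)⁻¹) =
      z' * ω' * a' * GLn.ofInfinite n K k := by
    refine archSP_ext_of_toMixed_of_sndHom ?_ ?_
    · simpa only [map_mul, archFS_toMixed_map_algebraMap, GLn.toMixed_ofFinite, mul_one,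
        GLn.toMixed_ofInfinite, mul_assoc] using hrel
    · simp only [map_mul, ImaginaryQuadratic.sndHom_map_algebraMap, GLn.sndHom_ofFinite,
        GLn.sndHom_ofInfinite, hz1, hω1, ha1, hz1', hω1', ha1', mul_one, one_mul, mul_inv_cancel]
  calc Matrix.GeneralLinearGroup.map (algebraMap K (AdeleRing (𝓞 K) K)) γ * (z * z₂) * s
      = Matrix.GeneralLinearGroup.map (algebraMap K (AdeleRing (𝓞 K) K)) γ *
          (z * (z₂ * s)) := by
        simp only [mul_assoc]
    _ = Matrix.GeneralLinearGroup.map (algebraMap K (AdeleRing (𝓞 K) K)) γ *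
          (z * (ω * GLn.ofFinite n K βf * a * GLn.ofFinite n K w)) := by
        rw [hzs]
    _ = Matrix.GeneralLinearGroup.map (algebraMap K (AdeleRing (𝓞 K) K)) γ *
          (z * ω * a * (GLn.ofFinite n K βf * GLn.ofFinite n K w)) := by
        rw [mul_assoc ω, ← hcomm]; simp only [mul_assoc]
    _ = Matrix.GeneralLinearGroup.map (algebraMap K (AdeleRing (𝓞 K) K)) γ *
          (z * ω * a * GLn.ofFinite n K
            (Matrix.GeneralLinearGroup.map (algebraMap K (FiniteAdeleRing (𝓞 K) K)) γ)⁻¹) := by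
        rw [hβw, map_mul]
    _ = z' * ω' * a' * GLn.ofInfinite n K k := hkey
    _ = z' * (ω' * GLn.ofFinite n K 1 * a' * GLn.ofInfinite n K k) := by
        rw [map_one]; simp only [mul_assoc, mul_one]
    _ = z' * z₂' * s' := by rw [← hzs']; simp only [mul_assoc]

end Summit.Langlands.Langlands.Theorems.HeckeEigenvalueField.Res
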